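import Mathlib
import HarnessLib
import Summits.NavierStokesRegularity.NavierStokesRegularity.Theses.RigidMotionDoor
import Summits.NavierStokesRegularity.NavierStokesRegularity.Theses.WanderingAxisDoor
import Summits.NavierStokesRegularity.NavierStokesRegularity.Theorems.RigidMotionDoorRigidZoom
import Summits.NavierStokesRegularity.NavierStokesRegularity.Theorems.RigidMotionDoorEuclidAccumulation
import Summits.NavierStokesRegularity.NavierStokesRegularity.Theorems.RigidMotionDoorTranslationEndLiouville
import Summits.NavierStokesRegularity.NavierStokesRegularity.Theorems.RigidMotionDoorAxisymEndLiouville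
import Summits.NavierStokesRegularity.NavierStokesRegularity.Theorems.RigidMotionDoorConstantSliceExtinction

/-!
# THE RIGID-MOTION DOOR IS CLOSED BY PROOF: `RigidMotionDoor.Target` (item stmt-NavierStokesRegularity-27901), and with it the
# wandering-axis door `WanderingAxisDoor.Target` (item stmt-NavierStokesRegularity-27761)

* `rigidMotionDoor_target_proof : RigidMotionDoor.Target` — the route's deciding theorem `closes` applied to the five PROVED items:
  `rigidMotionDoor_rigidZoom_proof` (27903, typer g33), `rigidMotionDoor_euclidAccumulation_proof` (27902, ns-imp-p1 g4),
  `rigidMotionDoor_translationEndLiouville_proof` (27904, ns-imp-p1 g4), `rigidMotionDoor_axisymEndLiouville_proof` (27765),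
  `rigidMotionDoor_constantSliceExtinction_proof` (27763) (twins by name, ns-imp-p1 g4).  THE DOOR (instrument criterion): a classical Leray–Hopf solution from rapidly
  decaying data, locally Type I at `(x₀,T)`, whose scale-invariant symmetry defect along SOME time-dependent normalised pitchless Killing field
  (precessing AND drifting axis, swirl allowed; or a translation) fades in mean square on every similarity ball about `x₀`, is backward bounded
  at `(x₀, T)`.
* `wanderingAxisDoor_target_proof : WanderingAxisDoor.Target` — the special case `b ≡ 0` (precessing axis through `x₀`; ns-idea-6's FACT 2).

HONEST FRAMING: two DOORS about HYPOTHETICAL locally Type-I blow-ups close by proof (unconditional, standard axioms).  A door is an instrument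
criterion — «a singularity cannot be asymptotically rigid-motion symmetric» — and proves NO summit statement: Navier–Stokes regularity (Clay A–D)
is OPEN and untouched by this file.
-/

noncomputable section

set_option linter.dupNamespace false

namespace Summit.NavierStokesRegularity.NavierStokesRegularity.Theorems

open Filter Topology

/-- **Item stmt-NavierStokesRegularity-27901** (`RigidMotionDoor.Target`): THE RIGID-MOTION DOOR, by the route's deciding theorem on the five
proved items. [cite: KochNadirashviliSereginSverak2009, Thm 5.1–5.2 and §4 (arXiv:0709.3599); SereginSverak2009, §3] -/
theorem rigidMotionDoor_target_proof :
    Summit.NavierStokesRegularity.NavierStokesRegularity.Theses.RigidMotionDoor.Target :=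
  Summit.NavierStokesRegularity.NavierStokesRegularity.Theses.RigidMotionDoor.closes
    rigidMotionDoor_rigidZoom_proof rigidMotionDoor_euclidAccumulation_proof
    rigidMotionDoor_translationEndLiouville_proof rigidMotionDoor_axisymEndLiouville_proof
    rigidMotionDoor_constantSliceExtinction_proof

/-- **Item stmt-NavierStokesRegularity-27761** (`WanderingAxisDoor.Target`): THE WANDERING-AXIS DOOR = the rigid-motion door with `b ≡ 0`
(a precessing axis through `x₀`: the field `y ↦ A t y` is pitchless with foot `c = 0`, and `‖A t‖ + ‖0‖ = 1`). [folklore] -/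
theorem wanderingAxisDoor_target_proof :
    Summit.NavierStokesRegularity.NavierStokesRegularity.Theses.WanderingAxisDoor.Target := by
  intro ν T hν hT u p hsol hLH hdec x₀ ρ M hρ hM A hA hfade
  refine rigidMotionDoor_target_proof ν T hν hT u p hsol hLH hdec x₀ ρ M hρ hM A (fun _ => 0) (fun t => ?_) ?_
  · refine ⟨(hA t).1, Or.inr ⟨0, fun y => by rw [sub_zero, add_zero]⟩, ?_⟩
    rw [norm_zero, add_zero]
    exact (hA t).2
  · intro R hR
    simpa only [add_zero] using hfade R hR

end Summit.NavierStokesRegularity.NavierStokesRegularity.Theorems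

end
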